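import Mathlib
import Summits.CriticalPhenomena.PercolationContinuityZ3.Theorems.PercNearOneGluingNoHeavyLowerTailSpiderAttachment
import Summits.CriticalPhenomena.PercolationContinuityZ3.Theorems.PercNearOneGluingNoHeavyLowerTailMarkovFirstEdgeSpiderUniform
import HarnessLib

/-!
# `NoHeavyLowerTail` (stmt-CriticalPhenomena-4575) — the SPIDER CLASS, hypothesis-free: leg independence (`μ(o ↮ A) ≤ e^{−Λ}`) and the
# `(r, L)`-uniform cumulative-isolation bound `μ(1 ≤ N_o ≤ j) ≤ 2e^{−Λ/3} + 72 M`

Seat `prim-cplus-engine` gen 7, 2026-08-19 (`--supports stmt-CriticalPhenomena-4575`).  No definitions, no named facts, no sorries.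

A SPIDER with VERTEX-DISJOINT legs: observer `o ∉ A`; for every `x ≠ o`, `x ∉ A` with `w(o,x) ≠ 0` an injective Steiner path `px x : Fin (kx x + 1) → Fin n`
off `A` and off `o`, `px x 0 = x`, whose vertices have (besides relays) no positive-weight non-relay neighbour other than their path neighbours and — for
`x` itself — `o`; distinct legs have disjoint vertex sets.  `Λ := Σ_{x ≠ o} w(o,x) · μ_{G∖s(o,x)}(x ↔ A)` (expected attached weight at `o`).

* `SpiderAttach.notAttached_le_exp` — **`μ_w(o ↮ A) ≤ exp(−Λ)`**: the events "pair `s(o,x)` open and `x` attached inside its own leg pairs" are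
  determined by pairwise disjoint pair sets, hence independent (`prodBernoulli_real_inter_biInter_of_determinedBy`); each has probability
  `w(o,x)·ṽ_x ≥ w(o,x)·v_x` (`SpiderAttach.attach_off_le_attach_within`); `o ↮ A` excludes all of them; `1 − u ≤ e^{−u}`.
* `SpiderAttach.spider_lowerTail_le` — with all pairs at `o` of weight `≤ 1/2`, leg path pairs `≤ 1/2` or `= 1`, and `M ≥ μ_w(|π(a)| ≤ j)` on `A`:
      **`μ_w(1 ≤ N_o ≤ j) ≤ 2 e^{−Λ/3} + 72 M`**      (`MarkovFirstEdge.spider_lowerTail_le_uniform` with its hypothesis discharged).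
  Uniform in the number and lengths of the legs, in `|A|` and in the relay side (legs may carry hairs to several relays: connector legs); `G`-form.
-/

namespace Summit.CriticalPhenomena.PercolationContinuityZ3.Theorems

open MeasureTheory Set
open Literature.Probability.LatticeModels (prodBernoulli prodBernoulli_real_setOf_mem
  prodBernoulli_real_inter_of_determinedBy prodBernoulli_real_inter_biInter_of_determinedBy)
open Literature.Probability.Percolation

noncomputable section
open Classical

variable {n : ℕ}

namespace SpiderAttach

/-- **Leg independence: `μ(o ↮ A) ≤ exp(−Λ)` for a spider with vertex-disjoint legs.** [this work] -/
theorem notAttached_le_exp (w : Sym2 (Fin n) → unitInterval) (A : Finset (Fin n)) (o : Fin n) (ho : o ∉ A)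
    (kx : Fin n → ℕ) (px : ∀ x : Fin n, Fin (kx x + 1) → Fin n)
    (hleg : ∀ x : Fin n, x ≠ o → x ∉ A → w s(o, x) ≠ 0 →
      Function.Injective (px x) ∧ px x 0 = x ∧ (∀ i, px x i ∉ A) ∧ (∀ i, px x i ≠ o) ∧
        (∀ (i : Fin (kx x + 1)) (v : Fin n), v ∉ A → v ≠ px x i → 0 < (w s(px x i, v) : ℝ) →
          (v = o ∧ i = 0) ∨ ∃ l : Fin (kx x + 1), v = px x l ∧ (l.val = i.val + 1 ∨ i.val = l.val + 1)))
    (hdisj : ∀ x x' : Fin n, x ≠ o → x ∉ A → w s(o, x) ≠ 0 → x' ≠ o → x' ∉ A → w s(o, x') ≠ 0 → x ≠ x' →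
      ∀ i i', px x i ≠ px x' i') :
    (prodBernoulli w).real (⋃ a ∈ A, (openConn o a : Set (BondConfig (Fin n))))ᶜ ≤
      Real.exp (-(∑ x ∈ (Finset.univ.filter fun x : Fin n => x ≠ o), (w s(o, x) : ℝ) *
        (prodBernoulli (pinW w ({s(o, x)} : Set (Sym2 (Fin n))) ∅)).real
          (⋃ a ∈ A, (openConn x a : Set (BondConfig (Fin n)))))) := by
  set μ := prodBernoulli w with hμ
  set P : Finset (Fin n) := Finset.univ.filter fun x : Fin n => x ≠ o with hP
  set Q : Finset (Fin n) := Finset.univ.filter fun x : Fin n => x ≠ o ∧ w s(o, x) ≠ 0 with hQ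
  -- leg pair sets (empty for relay neighbours)
  set D : Fin n → Finset (Sym2 (Fin n)) := fun x =>
    if x ∈ A then ∅ else
      ((Finset.univ : Finset (Fin (kx x + 1))) ×ˢ (A ∪ Finset.univ.image (px x))).image fun iv => s(px x iv.1, iv.2) with hD
  set E : Fin n → Finset (Sym2 (Fin n)) := fun x => insert s(o, x) (D x) with hE
  set U : Fin n → Set (BondConfig (Fin n)) := fun x => ⋃ a ∈ A, (openConn x a : Set (BondConfig (Fin n))) with hU
  set G : Fin n → Set (BondConfig (Fin n)) := fun x => {ω | ω ∩ (↑(D x) : Set (Sym2 (Fin n))) ∈ U x} with hG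
  set F : Fin n → Set (BondConfig (Fin n)) := fun x => {ω : BondConfig (Fin n) | s(o, x) ∈ ω} ∩ G x with hF
  have hQo : ∀ x ∈ Q, x ≠ o := fun x hx => (Finset.mem_filter.1 hx).2.1
  have hQw : ∀ x ∈ Q, w s(o, x) ≠ 0 := fun x hx => (Finset.mem_filter.1 hx).2.2
  -- membership in the leg pair sets
  have hDmem : ∀ x, x ∉ A → ∀ e, e ∈ D x ↔ ∃ i v, (v ∈ A ∨ ∃ l, v = px x l) ∧ e = s(px x i, v) := by
    intro x hxA e
    simp only [hD, hxA, if_false, Finset.mem_image, Finset.mem_product, Finset.mem_univ, true_and, Finset.mem_union,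
      Finset.mem_image, Prod.exists]
    constructor
    · rintro ⟨i, v, hv, rfl⟩
      refine ⟨i, v, ?_, rfl⟩
      rcases hv with hv | hv
      · exact Or.inl hv
      · right
        obtain ⟨l, hl⟩ := hv
        exact ⟨l, hl.symm⟩
    · rintro ⟨i, v, hv, rfl⟩
      refine ⟨i, v, ?_, rfl⟩
      rcases hv with hv | ⟨l, hl⟩
      · exact Or.inl hv
      · exact Or.inr ⟨l, hl.symm⟩
  have hDA : ∀ x, x ∉ A → ∀ i, ∀ a ∈ A, s(px x i, a) ∈ D x :=
    fun x hxA i a ha => (hDmem x hxA _).2 ⟨i, a, Or.inl ha, rfl⟩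
  have hDp : ∀ x, x ∉ A → ∀ i l, s(px x i, px x l) ∈ D x :=
    fun x hxA i l => (hDmem x hxA _).2 ⟨i, px x l, Or.inr ⟨l, rfl⟩, rfl⟩
  -- no leg pair contains `o`
  have hoD : ∀ x ∈ Q, ∀ e ∈ D x, o ∉ e := by
    intro x hx e he hoe
    by_cases hxA : x ∈ A
    · simp [hD, hxA] at he
    obtain ⟨hinj, h0, hpA, hpo, -⟩ := hleg x (hQo x hx) hxA (hQw x hx)
    obtain ⟨i, v, hv, rfl⟩ := (hDmem x hxA e).1 he
    rcases Sym2.mem_iff.1 hoe with h | h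
    · exact hpo i h.symm
    · rcases hv with hv | ⟨l, hl⟩
      · exact ho (h ▸ hv)
      · exact hpo l (hl ▸ h).symm
  -- every leg pair has an endpoint on the leg
  have hDleg : ∀ x ∈ Q, x ∉ A → ∀ e ∈ D x, ∃ i, px x i ∈ e := by
    intro x hx hxA e he
    obtain ⟨i, v, -, rfl⟩ := (hDmem x hxA e).1 he
    exact ⟨i, Sym2.mem_mk_left _ _⟩
  -- the other endpoint is a relay or on the leg
  have hDother : ∀ x ∈ Q, x ∉ A → ∀ e ∈ D x, ∀ u ∈ e, u ∈ A ∨ ∃ l, u = px x l := by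
    intro x hx hxA e he u hu
    obtain ⟨i, v, hv, rfl⟩ := (hDmem x hxA e).1 he
    rcases Sym2.mem_iff.1 hu with rfl | rfl
    · exact Or.inr ⟨i, rfl⟩
    · exact hv
  -- pairwise disjointness of the pair sets `E x`, `x ∈ Q`
  have hEdisj : (↑Q : Set (Fin n)).PairwiseDisjoint E := by
    intro x hx x' hx' hxx'
    have hxQ : x ∈ Q := Finset.mem_coe.1 hx
    have hx'Q : x' ∈ Q := Finset.mem_coe.1 hx'
    rw [Function.onFun, Finset.disjoint_left]
    intro e he he'
    simp only [hE, Finset.mem_insert] at he he'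
    -- helper: a leg pair of `x` is not a leg pair of `x'`
    have key : ∀ y ∈ Q, ∀ y' ∈ Q, y ≠ y' → ∀ f ∈ D y, f ∉ D y' := by
      intro y hy y' hy' hyy' f hf hf'
      by_cases hyA : y ∈ A
      · simp [hD, hyA] at hf
      by_cases hy'A : y' ∈ A
      · simp [hD, hy'A] at hf'
      obtain ⟨i, hi⟩ := hDleg y hy hyA f hf
      rcases hDother y' hy' hy'A f hf' (px y i) hi with h | ⟨l, hl⟩
      · exact (hleg y (hQo y hy) hyA (hQw y hy)).2.2.1 i h
      · exact hdisj y y' (hQo y hy) hyA (hQw y hy) (hQo y' hy') hy'A (hQw y' hy') hyy' i l hl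
    rcases he with rfl | he
    · rcases he' with h | he'
      · exact hxx' (Sym2.congr_right.1 h)
      · exact hoD x' hx'Q _ he' (Sym2.mem_mk_left _ _)
    · rcases he' with rfl | he'
      · exact hoD x hxQ _ he (Sym2.mem_mk_left _ _)
      · exact key x hxQ x' hx'Q hxx' e he he'
  -- `s(o,x) ∉ D x`
  have hoxD : ∀ x ∈ Q, s(o, x) ∉ D x := fun x hx h => hoD x hx _ h (Sym2.mem_mk_left _ _)
  -- determinacy
  have hGdet : ∀ x, DeterminedBy (G x) (↑(D x) : Set (Sym2 (Fin n))) := fun x => determinedBy_attach_within A x _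
  have hFdet : ∀ x, DeterminedBy (F x) (↑(E x) : Set (Sym2 (Fin n))) := by
    intro x
    refine DeterminedBy.inter ?_ ((hGdet x).mono fun e he => ?_)
    · rw [determinedBy_iff]
      intro ω ω' h
      have := Set.ext_iff.1 h s(o, x)
      simp only [hE, Finset.coe_insert, mem_inter_iff, mem_insert_iff, true_or, and_true] at this
      simp only [mem_setOf_eq, this]
    · simp only [hE, Finset.coe_insert, mem_insert_iff]
      exact Or.inr he
  -- STEP 1: `{o ↮ A} ⊆ ⋂_{x ∈ Q} (F x)ᶜ`
  have hcover : (⋃ a ∈ A, (openConn o a : Set (BondConfig (Fin n))))ᶜ ⊆ ⋂ x ∈ Q, (F x)ᶜ := by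
    intro ω hω
    rw [Set.mem_iInter₂]
    intro x hx hFx
    apply hω
    obtain ⟨hox, hGx⟩ := hFx
    have hGx' : ω ∩ (↑(D x) : Set (Sym2 (Fin n))) ∈ U x := hGx
    rw [hU, Set.mem_iUnion₂] at hGx'
    obtain ⟨a, ha, hxa⟩ := hGx'
    rw [Set.mem_iUnion₂]
    refine ⟨a, ha, ?_⟩
    have hxa' : ω ∈ openConn x a := isUpperSet_openConn x a Set.inter_subset_left hxa
    have hadj : (openGraph ω).Adj o x := (openGraph_adj ω o x).2 ⟨hox, (hQo x hx).symm⟩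
    exact (hadj.reachable.trans hxa' : (openGraph ω).Reachable o a)
  -- STEP 2: independence
  have hprod : μ.real (⋂ x ∈ Q, (F x)ᶜ) = ∏ x ∈ Q, μ.real (F x)ᶜ := by
    have hdetc : ∀ x, DeterminedBy (F x)ᶜ (↑(E x) : Set (Sym2 (Fin n))) := by
      intro x
      have h := hFdet x
      rw [determinedBy_iff] at h ⊢
      intro ω ω' hh
      rw [Set.mem_compl_iff, Set.mem_compl_iff, h ω ω' hh]
    have h := prodBernoulli_real_inter_biInter_of_determinedBy w Q E hEdisj (C := fun x => (F x)ᶜ)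
      (fun x _ => hdetc x) (fun x _ => MeasurableSet.of_discrete)
      (A := Set.univ) (determinedBy_univ _) MeasurableSet.univ
    rw [Set.univ_inter, probReal_univ, one_mul] at h
    exact h
  -- STEP 3: each factor
  have hfac : ∀ x ∈ Q, μ.real (F x)ᶜ ≤ Real.exp (-((w s(o, x) : ℝ) *
      (prodBernoulli (pinW w ({s(o, x)} : Set (Sym2 (Fin n))) ∅)).real (U x))) := by
    intro x hx
    -- `μ(F x) = w(o,x) · μ(G x)`
    have hFx : μ.real (F x) = (w s(o, x) : ℝ) * μ.real (G x) := by
      have hA' : DeterminedBy {ω : BondConfig (Fin n) | s(o, x) ∈ ω} (↑({s(o, x)} : Finset (Sym2 (Fin n))) : Set _) := by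
        rw [determinedBy_iff]
        intro ω ω' h
        have := Set.ext_iff.1 h s(o, x)
        simp only [Finset.coe_singleton, mem_inter_iff, mem_singleton_iff, and_true] at this
        simp only [mem_setOf_eq, this]
      have hB' : DeterminedBy (G x) (↑({s(o, x)} : Finset (Sym2 (Fin n))) : Set _)ᶜ :=
        (hGdet x).mono fun e he heq => by
          rw [Finset.coe_singleton, mem_singleton_iff] at heq
          exact hoxD x hx (heq ▸ Finset.mem_coe.1 he)
      rw [hF]
      exact (prodBernoulli_real_inter_of_determinedBy w {s(o, x)} hA' hB' MeasurableSet.of_discrete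
        MeasurableSet.of_discrete).trans (by rw [prodBernoulli_real_setOf_mem])
    -- `v_x ≤ μ(G x)`
    have hv : (prodBernoulli (pinW w ({s(o, x)} : Set (Sym2 (Fin n))) ∅)).real (U x) ≤ μ.real (G x) := by
      rw [← ObserverUnionBoundG.real_preimage_diff_eq_pinW w (U x) s(o, x)]
      by_cases hxA : x ∈ A
      · -- relay neighbour: `G x` is the sure event
        have hGuniv : G x = Set.univ := by
          refine Set.eq_univ_of_forall fun ω => ?_
          simp only [hG, hU, mem_setOf_eq, Set.mem_iUnion₂]
          exact ⟨x, hxA, (SimpleGraph.Reachable.refl x : (openGraph _).Reachable x x)⟩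
        rw [hGuniv, probReal_univ]
        exact measureReal_le_one
      · obtain ⟨hinj, h0, hpA, hpo, hpath⟩ := hleg x (hQo x hx) hxA (hQw x hx)
        have h := attach_off_le_attach_within w A o (px x) hpA hpath (↑(D x) : Set (Sym2 (Fin n)))
          (fun i a ha => Finset.mem_coe.2 (hDA x hxA i a ha)) (fun i l => Finset.mem_coe.2 (hDp x hxA i l))
        rw [h0] at h
        exact h
    have hw0 : 0 ≤ (w s(o, x) : ℝ) := (w _).2.1
    rw [probReal_compl_eq_one_sub MeasurableSet.of_discrete, hFx]
    have h1 : 1 - (w s(o, x) : ℝ) * μ.real (G x) ≤ Real.exp (-((w s(o, x) : ℝ) * μ.real (G x))) := by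
      have := Real.add_one_le_exp (-((w s(o, x) : ℝ) * μ.real (G x))); linarith
    refine h1.trans (Real.exp_le_exp.2 ?_)
    nlinarith [mul_le_mul_of_nonneg_left hv hw0]
  -- STEP 4: assemble
  have hsumQ : ∑ x ∈ Q, (w s(o, x) : ℝ) * (prodBernoulli (pinW w ({s(o, x)} : Set (Sym2 (Fin n))) ∅)).real (U x) =
      ∑ x ∈ P, (w s(o, x) : ℝ) * (prodBernoulli (pinW w ({s(o, x)} : Set (Sym2 (Fin n))) ∅)).real (U x) := by
    have hQP : Q = P.filter fun x => w s(o, x) ≠ 0 := by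
      ext x; simp only [hQ, hP, Finset.mem_filter, Finset.mem_univ, true_and]
    rw [hQP, Finset.sum_filter]
    refine Finset.sum_congr rfl fun x _ => ?_
    by_cases hw : w s(o, x) ≠ 0
    · rw [if_pos hw]
    · rw [if_neg hw]
      push Not at hw
      have : (w s(o, x) : ℝ) = 0 := by rw [hw]; rfl
      rw [this, zero_mul]
  calc μ.real (⋃ a ∈ A, (openConn o a : Set (BondConfig (Fin n))))ᶜ
      ≤ μ.real (⋂ x ∈ Q, (F x)ᶜ) := measureReal_mono hcover (measure_ne_top _ _)
    _ = ∏ x ∈ Q, μ.real (F x)ᶜ := hprod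
    _ ≤ ∏ x ∈ Q, Real.exp (-((w s(o, x) : ℝ) *
          (prodBernoulli (pinW w ({s(o, x)} : Set (Sym2 (Fin n))) ∅)).real (U x))) :=
        Finset.prod_le_prod (fun x _ => measureReal_nonneg) hfac
    _ = Real.exp (-(∑ x ∈ Q, (w s(o, x) : ℝ) *
          (prodBernoulli (pinW w ({s(o, x)} : Set (Sym2 (Fin n))) ∅)).real (U x))) := by
        rw [← Finset.sum_neg_distrib, Real.exp_sum]
    _ = _ := by rw [hsumQ]

/-- **The spider class, `(r, L)`-uniform and hypothesis-free** (up to the weight normalisation): vertex-disjoint legs as in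
`notAttached_le_exp` with path pairs `≤ 1/2` or `= 1`, all pairs at `o` of weight `≤ 1/2`, `0 ≤ M` with `μ_w(|π(a)| ≤ j) ≤ M` on `A`.  Then
`μ_w(1 ≤ N_o ≤ j) ≤ 2 e^{−Λ/3} + 72 M`, `Λ = Σ_{x ≠ o} w(o,x)·μ_{G∖s(o,x)}(x ↔ A)`. [this work] -/
theorem spider_lowerTail_le (w : Sym2 (Fin n) → unitInterval) (A : Finset (Fin n)) (o : Fin n) (ho : o ∉ A) (j : ℕ)
    (M : ℝ) (hM : 0 ≤ M) (hhalf : ∀ x : Fin n, x ≠ o → (w s(o, x) : ℝ) ≤ 1 / 2)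
    (hlightG : ∀ a ∈ A, (prodBernoulli w).real
      {ω : BondConfig (Fin n) | (A.filter fun z => ω ∈ openConn a z).card ≤ j} ≤ M)
    (kx : Fin n → ℕ) (px : ∀ x : Fin n, Fin (kx x + 1) → Fin n)
    (hleg : ∀ x : Fin n, x ≠ o → x ∉ A → w s(o, x) ≠ 0 →
      Function.Injective (px x) ∧ px x 0 = x ∧ (∀ i, px x i ∉ A) ∧ (∀ i, px x i ≠ o) ∧
        (∀ (i : Fin (kx x + 1)) (v : Fin n), v ∉ A → v ≠ px x i → 0 < (w s(px x i, v) : ℝ) →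
          (v = o ∧ i = 0) ∨ ∃ l : Fin (kx x + 1), v = px x l ∧ (l.val = i.val + 1 ∨ i.val = l.val + 1)) ∧
        (∀ l : Fin (kx x), (w s(px x l.castSucc, px x l.succ) : ℝ) ≤ 1 / 2 ∨ w s(px x l.castSucc, px x l.succ) = 1))
    (hdisj : ∀ x x' : Fin n, x ≠ o → x ∉ A → w s(o, x) ≠ 0 → x' ≠ o → x' ∉ A → w s(o, x') ≠ 0 → x ≠ x' →
      ∀ i i', px x i ≠ px x' i') :
    (prodBernoulli w).real {ω : BondConfig (Fin n) |
        1 ≤ (A.filter fun a => ω ∈ openConn o a).card ∧ (A.filter fun a => ω ∈ openConn o a).card ≤ j} ≤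
      2 * Real.exp (-((∑ x ∈ (Finset.univ.filter fun x : Fin n => x ≠ o), (w s(o, x) : ℝ) *
        (prodBernoulli (pinW w ({s(o, x)} : Set (Sym2 (Fin n))) ∅)).real
          (⋃ a ∈ A, (openConn x a : Set (BondConfig (Fin n))))) / 3)) + 72 * M := by
  set Λ : ℝ := ∑ x ∈ (Finset.univ.filter fun x : Fin n => x ≠ o), (w s(o, x) : ℝ) *
    (prodBernoulli (pinW w ({s(o, x)} : Set (Sym2 (Fin n))) ∅)).real
      (⋃ a ∈ A, (openConn x a : Set (BondConfig (Fin n)))) with hΛ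
  have hΛ0 : 0 ≤ Λ := Finset.sum_nonneg fun x _ => mul_nonneg (w _).2.1 measureReal_nonneg
  by_cases hΛpos : 0 < Λ
  · have hlegs' : ∀ x : Fin n, x ≠ o → x ∉ A → w s(o, x) ≠ 0 →
        ∃ (k : ℕ) (p : Fin (k + 1) → Fin n), Function.Injective p ∧ p 0 = x ∧ (∀ i, p i ∉ A) ∧
          (∀ (i : Fin (k + 1)) (v : Fin n), v ∉ A → v ≠ p i → 0 < (w s(p i, v) : ℝ) →
            (v = o ∧ i = 0) ∨ ∃ l : Fin (k + 1), v = p l ∧ (l.val = i.val + 1 ∨ i.val = l.val + 1)) ∧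
          (∀ l : Fin k, (w s(p l.castSucc, p l.succ) : ℝ) ≤ 1 / 2 ∨ w s(p l.castSucc, p l.succ) = 1) := by
      intro x hxo hxA hw
      obtain ⟨hinj, h0, hpA, -, hpath, hhalfleg⟩ := hleg x hxo hxA hw
      exact ⟨kx x, px x, hinj, h0, hpA, hpath, hhalfleg⟩
    have hleg0 : ∀ x : Fin n, x ≠ o → x ∉ A → w s(o, x) ≠ 0 →
        Function.Injective (px x) ∧ px x 0 = x ∧ (∀ i, px x i ∉ A) ∧ (∀ i, px x i ≠ o) ∧
          (∀ (i : Fin (kx x + 1)) (v : Fin n), v ∉ A → v ≠ px x i → 0 < (w s(px x i, v) : ℝ) →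
            (v = o ∧ i = 0) ∨ ∃ l : Fin (kx x + 1), v = px x l ∧ (l.val = i.val + 1 ∨ i.val = l.val + 1)) := by
      intro x hxo hxA hw
      obtain ⟨hinj, h0, hpA, hpo, hpath, -⟩ := hleg x hxo hxA hw
      exact ⟨hinj, h0, hpA, hpo, hpath⟩
    have hδ := notAttached_le_exp w A o ho kx px hleg0 hdisj
    exact MarkovFirstEdge.spider_lowerTail_le_uniform w A o ho j M hM hhalf hlightG hlegs' Λ hΛpos le_rfl hδ
  · -- `Λ = 0`: the bound is trivial
    have h1 : (prodBernoulli w).real {ω : BondConfig (Fin n) |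
        1 ≤ (A.filter fun a => ω ∈ openConn o a).card ∧ (A.filter fun a => ω ∈ openConn o a).card ≤ j} ≤ 1 :=
      measureReal_le_one
    have hΛz : Λ = 0 := le_antisymm (not_lt.1 hΛpos) hΛ0
    rw [hΛz, zero_div, neg_zero, Real.exp_zero]
    linarith

end SpiderAttach

end

end Summit.CriticalPhenomena.PercolationContinuityZ3.Theorems
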